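import Summits.HodgeConjecture.HodgeCM.Model.HypCensus.ArchFactor_1

/-! PORT of `HodgeCM/Model/HypCensus/ArchFactor.lean` (HodgeCMPerL run 81) — part 2: continuation of `Summits.HodgeConjecture.HodgeCM.Model.HypCensus.ArchFactor_1` (split at a top-level declaration boundary by port_pkg.py; scope re-opened below; declarations unchanged). -/

-- port_pkg: scope re-opened for this part (file-level context, then the namespace/section stack open at the cut)
set_option autoImplicit false
noncomputable section
open NumberField IsDedekindDomain
open scoped Matrix
open scoped Kronecker Classical
open Literature.NumberTheory.Automorphic Literature.NumberTheory.Weil1964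
open Literature.RepresentationTheory.HeisenbergGroup (polar Heisenberg symplecticGroup ofSymplectic ofSymplectic_σ ofSymplectic_f)
open scoped TensorProduct
open Literature.NumberTheory.GelbartRogawski1991
namespace HodgeCM.Model.HypCensus
section Pair
variable (F E : Type) [Field F] [NumberField F] [Field E] [NumberField E] [Algebra F E]
variable (c : E ≃ₐ[F] E) (N M : ℕ) (JV : Matrix (Fin N) (Fin N) E) (JW : Matrix (Fin M) (Fin M) E)
/-- **Each `archWeilRep … u` is continuous** on `𝓢((F ⊗ ℝ)^n)` (LF-continuity of `Mp_ψ(𝕎_𝔸)ᶜᵒⁿᵗ`). -/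
theorem continuous_archWeilRep [Algebra.IsQuadraticExtension F E] {δ : E} (hcδ : c δ = -δ) (hδ : δ ≠ 0)
    {d : F} (hd : δ * δ = algebraMap F E d) {TV : Matrix (Fin N) (Fin N) F} {TW : Matrix (Fin M) (Fin M) F}
    (hV : TV.IsSymm) (hW : TW.IsSymm) (hVd : IsUnit TV.det) (hWd : IsUnit TW.det)
    (hJV : JV = TV.map (algebraMap F E)) (hJW : JW = TW.map (algebraMap F E))
    {n : ℕ} (e : Fin N × Fin M ≃ Fin n)
    (s : UnitaryGroup.adelicPair F E c N M JV JW →* adelicMpCont F (Fin n) (UnitaryDualPair.adelicGram F e TV TW))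
    (hs : ∀ g, adelicMpCont.proj F (Fin n) (UnitaryDualPair.adelicGram F e TV TW) (s g) =
      UnitaryDualPair.toSp F E c N M e JV JW hcδ hδ hd hV hW hJV hJW g)
    (u : UnitaryGroup.arch F E c N JV × UnitaryGroup.arch F E c M JW) :
    Continuous (archWeilRep F E c N M JV JW hcδ hδ hd hV hW hVd hWd hJV hJW e s hs u) :=
  continuous_archRepMp _ ((UnitaryDualPair.pairSplitting F E c N M e JV JW s).comp (archProdHom F E c N M JV JW)) _ u

end Pair

end HodgeCM.Model.HypCensus

end
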